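/-
Copyright (c) 2026 the pub-hodgecm-mathlib formalisation cell (harness21).  Prover seat hodgecm-mathlib-K2E1-p15 (g0), Track B ∕ K2-LIT «5Res», h413 = `stmt-HodgeConjecture-24833`,
line `K2_E1_TraceFormulaBeta`, route of record `HCCMUnconditional`; dealer K2E1-plan (g7) deals (217)∕(218) «F3c», head bytes of the consumer K2E1-p10 (g2) (`K2/STATUS.md`
2026-09-04T12:22:05Z; F3d `K2E1PseudoEisensteinFamilyDecompositionU2` instantiates `C := C_L¹ = T(𝔸)¹ ⧸ T(F)`, `X := N(𝔸)B(F)∖G(𝔸)`).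
-/
import Literature.RepresentationTheory.CompactGroups.AbelianCharacterSeparation   -- ★ `charSeparating` (Pontryagin–van Kampen, compact abelian), `spanStarSubalgebra`, `charCM`, `star_charCM`
import HarnessLib

/-!
# K2·E1 — `K2E1CompactAbelianIsotypicApproximationU`: ISOTYPIC (FOURIER) APPROXIMATION FOR A CONTINUOUS ACTION OF A COMPACT ABELIAN GROUP — a compactly supported continuous
# `ψ : X → ℂ` is UNIFORMLY approximated by finite sums of its isotypic projections `P_χ ψ (x) = ∫_C χ̄(c)·ψ(c • x) dc` (Fejér ∕ Stone–Weierstrass on `C`)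

Track B ∕ K2-LIT, crux h413 = `stmt-HodgeConjecture-24833`; cell `hodgecm-mathlib`, squad K2, ENGINE E1, ROADCARD C7 (b)(c) «families»; FILE F3c of K2E1-p10 (g2)'s split F3a–F3d
(the ONE abstract file — no automorphic objects).  THEOREMS ONLY (no `def`, no `instance`, no notation, no named-fact hypothesis, no `sorry`); lane `--kind proof --supports
stmt-HodgeConjecture-24833 --as helper` (count-neutral).  Closes no socket.

SETTING.  `C` a compact Hausdorff abelian topological group with its Borel σ-algebra and a left-invariant probability measure `μC` (normalised Haar); `X` a topological space with a
continuous action of `C`; characters `χ : PontryaginDual C` with values `((χ c : Circle) : ℂ)`; the ISOTYPIC PROJECTION is written inline: `P_χ ψ (x) := ∫ c, star ((χ c : Circle) : ℂ) *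
ψ (c • x) ∂μC`.
* §1 (L1) **`continuous_isotypic`** (`ψ` continuous ⇒ `P_χ ψ` continuous — proved WITHOUT countability on `X`: currying into `C(C, ℂ)` with its sup metric and the Lipschitz functional `∫ · dμC`),
  (L2) **`isotypic_smul`** (`P_χ ψ (c₀ • x) = χ(c₀)·P_χ ψ (x)`: `χ`-ISOTYPY, left-invariance), (L3) **`norm_isotypic_le`** (`‖ψ‖ ≤ M ⇒ ‖P_χ ψ‖ ≤ M`), (L4) **`isotypic_eq_zero_of_forall`**
  (`ψ(c • x) = 0 ∀ c ⇒ P_χ ψ (x) = 0`), (L5) **`isotypic_mul_of_invariant`** (`P_χ (m·ψ) = m·P_χ ψ` for `C`-invariant `m`).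
* §2 HEAD **`exists_finset_character_isotypic_approx`**: `ψ` continuous with compact support, `ε > 0` ⟹ `∃ s a, ∀ x, ‖ψ x − Σ_{χ ∈ s} a χ · P_χ ψ (x)‖ ≤ ε`.  ROUTE (Fejér): a
  neighbourhood `u ∋ 1` with `‖ψ(c • x) − ψ x‖ ≤ ε∕2` for `c ∈ u` and ALL `x` (generalized tube lemma on `{1} × C • tsupport ψ`; off `C • tsupport ψ` both vanish); an Urysohn bump `b ≥ 0`
  at `1` supported in `u`, `∫ b > 0` (a left-invariant probability on a compact group charges opens); a trigonometric polynomial `p = Σ a′_χ χ` with `‖p − b∕∫b‖_∞ ≤ ε∕(2(M+1))`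
  (Stone–Weierstrass for the star-subalgebra spanned by the characters, which separate points by ★ `charSeparating`); then `∫ p(c) ψ(c • x) dc = Σ a′_χ P_{χ⁻¹} ψ (x)` and
  `‖ψ − ∫ p ψ(· • x)‖ ≤ ‖ψ − ∫ (b∕∫b) ψ(· • x)‖ + ‖∫ (b∕∫b − p) ψ(· • x)‖ ≤ ε∕2 + ε∕2`.

HONEST LABEL: HC_CM is proved only modulo the 7 printed citations (2 remaining named inputs: hLiu418 = `stmt-HodgeConjecture-24832`, h413 = `stmt-HodgeConjecture-24833`) until rung 0
closes; this file is letter-free functional analysis and closes no socket.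

## References
* [DeitmarEchterhoff2014] A. Deitmar, S. Echterhoff, *Principles of Harmonic Analysis*, 2nd ed. (2014), Prop. 3.5.2, Thm. 3.4.6 (Plancherel ∕ Fourier on compact abelian groups).
* [BrockerTomDieck1985] T. Bröcker, T. tom Dieck, *Representations of Compact Lie Groups*, GTM 98 (1985), III (5.1), (5.10).
* [Folland1995] G. B. Folland, *A Course in Abstract Harmonic Analysis* (1995), §4.2 (Fejér-type approximate identities), Thm. 5.11.
-/

set_option autoImplicit false
set_option linter.dupNamespace false  -- the mandated namespace repeats the summit's segment (`HodgeConjecture.HodgeConjecture`)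

noncomputable section

open MeasureTheory Set Filter Topology
open Literature.RepresentationTheory.CompactGroups

namespace Summit.HodgeConjecture.HodgeConjecture.Cruxes.H413.K2E1CompactAbelianIsotypicApproximationU

variable {C : Type*} [CommGroup C] [TopologicalSpace C] [IsTopologicalGroup C] [CompactSpace C] [T2Space C] [MeasurableSpace C] [BorelSpace C]
  (μC : Measure C) [IsProbabilityMeasure μC] [μC.IsMulLeftInvariant]
  {X : Type*} [TopologicalSpace X] [MulAction C X] [ContinuousSMul C X]

/-! ## §0 Two integration lemmas on the compact group -/

omit [CommGroup C] [IsTopologicalGroup C] [T2Space C] [μC.IsMulLeftInvariant] in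
/-- A continuous function on the compact group is integrable for the probability measure. [folklore] -/
theorem integrable_of_continuous {E : Type*} [NormedAddCommGroup E] {f : C → E} (hf : Continuous f) : Integrable f μC :=
  hf.integrable_of_hasCompactSupport (HasCompactSupport.of_compactSpace f)

omit [CommGroup C] [IsTopologicalGroup C] [T2Space C] [μC.IsMulLeftInvariant] in
/-- **The integral is continuous on `C(C, ℂ)` for the sup metric** (`‖∫ g − ∫ g′‖ ≤ ‖g − g′‖_∞` for a probability measure). [folklore] -/
theorem continuous_integral_continuousMap : Continuous fun g : C(C, ℂ) => ∫ c, g c ∂μC := by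
  refine continuous_iff_continuousAt.2 fun g₀ => Metric.continuousAt_iff.2 fun ε hε => ⟨ε / 2, by positivity, fun g hg => ?_⟩
  rw [dist_eq_norm, ← integral_sub (integrable_of_continuous μC g.continuous) (integrable_of_continuous μC g₀.continuous)]
  calc ‖∫ c, (g c - g₀ c) ∂μC‖ ≤ dist g g₀ * μC.real Set.univ :=
        norm_integral_le_of_norm_le_const (Filter.Eventually.of_forall fun c => by
          rw [← dist_eq_norm]; exact ContinuousMap.dist_apply_le_dist c)
    _ = dist g g₀ := by rw [probReal_univ, mul_one]
    _ < ε := hg.trans (by linarith)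

/-! ## §1 The isotypic projections: continuity, isotypy, bounds -/

omit [IsTopologicalGroup C] [T2Space C] [μC.IsMulLeftInvariant] in
/-- (L1) **`P_χ ψ` IS CONTINUOUS** for continuous `ψ` (no countability on `X`: curry the jointly continuous integrand into `C(C, ℂ)` and compose with §0). [cite: Folland1995, §4.2] -/
theorem continuous_isotypic {ψ : X → ℂ} (hψ : Continuous ψ) (χ : PontryaginDual C) :
    Continuous fun x : X => ∫ c, star ((χ c : Circle) : ℂ) * ψ (c • x) ∂μC := by
  have hF : Continuous fun p : X × C => star ((χ p.2 : Circle) : ℂ) * ψ (p.2 • p.1) :=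
    ((continuous_star.comp (continuous_subtype_val.comp ((map_continuous χ).comp continuous_snd))).mul
      (hψ.comp (continuous_snd.smul continuous_fst)))
  exact (continuous_integral_continuousMap μC).comp (ContinuousMap.curry ⟨_, hF⟩).continuous

omit [CompactSpace C] [T2Space C] [IsProbabilityMeasure μC] [TopologicalSpace X] [ContinuousSMul C X] in
/-- (L2) **`χ`-ISOTYPY: `P_χ ψ (c₀ • x) = χ(c₀) · P_χ ψ (x)`** (substitute `c ↦ c₀⁻¹c`, left-invariance of `μC`; `conj χ(c₀⁻¹) = χ(c₀)`). [cite: BrockerTomDieck1985, III (5.5)] -/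
theorem isotypic_smul (ψ : X → ℂ) (χ : PontryaginDual C) (c₀ : C) (x : X) :
    (∫ c, star ((χ c : Circle) : ℂ) * ψ (c • (c₀ • x)) ∂μC) = ((χ c₀ : Circle) : ℂ) * ∫ c, star ((χ c : Circle) : ℂ) * ψ (c • x) ∂μC := by
  have h1 : (fun c => star ((χ c : Circle) : ℂ) * ψ (c • (c₀ • x))) = fun c => (fun d => star ((χ (c₀⁻¹ * d) : Circle) : ℂ) * ψ (d • x)) (c₀ * c) := by
    funext c
    show _ = star ((χ (c₀⁻¹ * (c₀ * c)) : Circle) : ℂ) * ψ ((c₀ * c) • x)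
    rw [inv_mul_cancel_left, mul_smul, smul_comm c₀ c x]
  rw [h1, integral_mul_left_eq_self (fun d => star ((χ (c₀⁻¹ * d) : Circle) : ℂ) * ψ (d • x)) c₀]
  have h2 : ∀ d, star ((χ (c₀⁻¹ * d) : Circle) : ℂ) = ((χ c₀ : Circle) : ℂ) * star ((χ d : Circle) : ℂ) := by
    intro d
    rw [map_mul, map_inv, Circle.coe_mul, star_mul', Circle.coe_inv_eq_conj, Complex.star_def, Complex.conj_conj, mul_comm]
  simp_rw [h2, mul_assoc]
  exact integral_const_mul _ _

omit [IsTopologicalGroup C] [CompactSpace C] [T2Space C] [BorelSpace C] [μC.IsMulLeftInvariant] [TopologicalSpace X] [ContinuousSMul C X] in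
/-- (L3) **`‖ψ‖ ≤ M ⟹ ‖P_χ ψ (x)‖ ≤ M`** (probability measure, `|χ| = 1`). [folklore] -/
theorem norm_isotypic_le {ψ : X → ℂ} {M : ℝ} (hM : ∀ x, ‖ψ x‖ ≤ M) (χ : PontryaginDual C) (x : X) :
    ‖∫ c, star ((χ c : Circle) : ℂ) * ψ (c • x) ∂μC‖ ≤ M := by
  have h := norm_integral_le_of_norm_le_const (μ := μC) (f := fun c => star ((χ c : Circle) : ℂ) * ψ (c • x)) (C := M)
    (Filter.Eventually.of_forall fun c => by rw [norm_mul, norm_star, Circle.norm_coe, one_mul]; exact hM _)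
  rwa [probReal_univ, mul_one] at h

omit [IsTopologicalGroup C] [CompactSpace C] [T2Space C] [BorelSpace C] [IsProbabilityMeasure μC] [μC.IsMulLeftInvariant] [TopologicalSpace X] [ContinuousSMul C X] in
/-- (L4) **`ψ(c • x) = 0` for all `c` ⟹ `P_χ ψ (x) = 0`** (the projection is supported on `C • supp ψ`). [folklore] -/
theorem isotypic_eq_zero_of_forall {ψ : X → ℂ} {x : X} (h : ∀ c : C, ψ (c • x) = 0) (χ : PontryaginDual C) :
    (∫ c, star ((χ c : Circle) : ℂ) * ψ (c • x) ∂μC) = 0 := by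
  simp only [h, mul_zero, integral_zero]

omit [IsTopologicalGroup C] [CompactSpace C] [T2Space C] [BorelSpace C] [IsProbabilityMeasure μC] [μC.IsMulLeftInvariant] [TopologicalSpace X] [ContinuousSMul C X] in
/-- (L5) **`P_χ (m·ψ) = m · P_χ ψ` FOR A `C`-INVARIANT FACTOR `m`** (pulls the radial factor of a pure tensor out). [folklore] -/
theorem isotypic_mul_of_invariant {m ψ : X → ℂ} (hm : ∀ (c : C) (x : X), m (c • x) = m x) (χ : PontryaginDual C) (x : X) :
    (∫ c, star ((χ c : Circle) : ℂ) * (m (c • x) * ψ (c • x)) ∂μC) = m x * ∫ c, star ((χ c : Circle) : ℂ) * ψ (c • x) ∂μC := by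
  simp_rw [hm, mul_left_comm _ (m x), integral_const_mul]

/-! ## §2 The head: uniform approximation by finite sums of isotypic projections -/

omit [TopologicalSpace C] [IsTopologicalGroup C] [CompactSpace C] [T2Space C] [MeasurableSpace C] [BorelSpace C] [ContinuousSMul C X] in
/-- Off the `C`-saturation of the support every translate of `ψ` vanishes. [folklore] -/
theorem apply_smul_eq_zero_of_not_mem {ψ : X → ℂ} {x : X} (hx : x ∉ (fun p : C × X => p.1 • p.2) '' (Set.univ ×ˢ tsupport ψ)) (c : C) :
    ψ (c • x) = 0 := by
  by_contra h
  exact hx ⟨(c⁻¹, c • x), ⟨Set.mem_univ _, subset_tsupport _ h⟩, inv_smul_smul c x⟩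

omit [IsTopologicalGroup C] [T2Space C] [MeasurableSpace C] [BorelSpace C] in
/-- **UNIFORM CONTINUITY ALONG THE ORBITS**: for `ψ` continuous with compact support and `ε > 0` there is an open `u ∋ 1` in `C` with `‖ψ(c • x) − ψ x‖ ≤ ε` for all `c ∈ u` and ALL `x`
(generalized tube lemma on `{1} × C • tsupport ψ`). [folklore] -/
theorem exists_nhds_one_forall_norm_sub_le {ψ : X → ℂ} (hψ : Continuous ψ) (hψs : HasCompactSupport ψ) {ε : ℝ} (hε : 0 < ε) :
    ∃ u : Set C, IsOpen u ∧ (1 : C) ∈ u ∧ ∀ c ∈ u, ∀ x : X, ‖ψ (c • x) - ψ x‖ ≤ ε := by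
  set K' : Set X := (fun p : C × X => p.1 • p.2) '' (Set.univ ×ˢ tsupport ψ) with hK'
  have hK'c : IsCompact K' := (isCompact_univ.prod hψs).image continuous_smul
  have hn : IsOpen {p : C × X | ‖ψ (p.1 • p.2) - ψ p.2‖ < ε} :=
    isOpen_lt (((hψ.comp continuous_smul).sub (hψ.comp continuous_snd)).norm) continuous_const
  have hsub : ({1} : Set C) ×ˢ K' ⊆ {p : C × X | ‖ψ (p.1 • p.2) - ψ p.2‖ < ε} := by
    rintro ⟨c, x⟩ ⟨hc, -⟩
    rw [Set.mem_singleton_iff] at hc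
    subst hc
    simp only [Set.mem_setOf_eq, one_smul, sub_self, norm_zero, hε]
  obtain ⟨u, v, hu, -, h1u, hKv, huv⟩ := generalized_tube_lemma isCompact_singleton hK'c hn hsub
  refine ⟨u, hu, h1u (Set.mem_singleton 1), fun c hc x => ?_⟩
  by_cases hx : x ∈ K'
  · exact (huv (Set.mk_mem_prod hc (hKv hx))).le
  · have h0 : ψ x = 0 := by simpa only [one_smul] using apply_smul_eq_zero_of_not_mem (C := C) hx 1
    rw [apply_smul_eq_zero_of_not_mem hx c, h0, sub_zero, norm_zero]
    exact hε.le

omit [MeasurableSpace C] [BorelSpace C] [TopologicalSpace X] [ContinuousSMul C X] in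
/-- **TRIGONOMETRIC POLYNOMIALS ARE SUP-DENSE ON A COMPACT ABELIAN GROUP**: every `g ∈ C(C, ℂ)` is within `δ` of some `Σ_{χ ∈ s} a χ · χ` (Stone–Weierstrass for the star-subalgebra spanned by the
characters ★ `spanStarSubalgebra (range charCM)`, separating by ★ `charSeparating`). [cite: DeitmarEchterhoff2014, Prop. 3.5.2] [cite: Folland1995, Thm. 5.11] -/
theorem exists_finset_character_sup_approx (g : C(C, ℂ)) {δ : ℝ} (hδ : 0 < δ) :
    ∃ (s : Finset (PontryaginDual C)) (a : PontryaginDual C → ℂ), ∀ c : C, ‖g c - ∑ χ ∈ s, a χ * ((χ c : Circle) : ℂ)‖ ≤ δ := by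
  classical
  let A := spanStarSubalgebra (Set.range (charCM (K := C))) ⟨1, charCM_one⟩
    (by rintro _ ⟨χ, rfl⟩ _ ⟨ψ, rfl⟩; exact ⟨χ * ψ, (charCM_mul χ ψ).symm⟩) (by rintro _ ⟨χ, rfl⟩; exact ⟨χ⁻¹, (star_charCM χ).symm⟩)
  have hA : A.SeparatesPoints := by
    intro k₁ k₂ hk
    obtain ⟨χ, hχ⟩ := charSeparating k₁ k₂ hk
    exact ⟨charCM χ, ⟨charCM χ, Submodule.subset_span ⟨χ, rfl⟩, rfl⟩, fun h => hχ (Circle.ext h)⟩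
  have hdense : g ∈ closure (Submodule.span ℂ (Set.range (charCM (K := C))) : Set C(C, ℂ)) := by
    have htop := ContinuousMap.starSubalgebra_topologicalClosure_eq_top_of_separatesPoints A hA
    have hg : g ∈ A.topologicalClosure := by rw [htop]; exact StarSubalgebra.mem_top
    exact hg
  obtain ⟨p, hp, hpg⟩ := Metric.mem_closure_iff.1 hdense δ hδ
  obtain ⟨l, rfl⟩ := (Finsupp.mem_span_range_iff_exists_finsupp.1 hp)
  refine ⟨l.support, fun χ => l χ, fun c => ?_⟩
  have happ : (l.sum fun χ a => a • charCM χ) c = ∑ χ ∈ l.support, l χ * ((χ c : Circle) : ℂ) := by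
    rw [Finsupp.sum, ContinuousMap.coe_sum, Finset.sum_apply]
    exact Finset.sum_congr rfl fun χ _ => by rw [ContinuousMap.coe_smul, Pi.smul_apply, smul_eq_mul, charCM_apply]
  rw [← happ, ← dist_eq_norm]
  exact ((ContinuousMap.dist_apply_le_dist c).trans hpg.le)

/-- **THE HEAD — ISOTYPIC APPROXIMATION.**  `C` compact Hausdorff abelian with a left-invariant probability `μC`, acting continuously on `X`; `ψ : X → ℂ` continuous with compact support; `ε > 0`.
THEN there are finitely many characters `χ ∈ s` and coefficients `a χ` with `‖ψ x − Σ_{χ ∈ s} a χ · ∫ conj χ(c)·ψ(c • x) dμC‖ ≤ ε` for EVERY `x` (module docstring, ROUTE (Fejér)).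
[cite: Folland1995, §4.2 and Thm. 5.11] [cite: DeitmarEchterhoff2014, Prop. 3.5.2] [cite: BrockerTomDieck1985, III (5.10)] -/
theorem exists_finset_character_isotypic_approx {ψ : X → ℂ} (hψ : Continuous ψ) (hψs : HasCompactSupport ψ) {ε : ℝ} (hε : 0 < ε) :
    ∃ (s : Finset (PontryaginDual C)) (a : PontryaginDual C → ℂ),
      ∀ x : X, ‖ψ x - ∑ χ ∈ s, a χ * ∫ c, star ((χ c : Circle) : ℂ) * ψ (c • x) ∂μC‖ ≤ ε := by
  classical
  haveI : μC.IsOpenPosMeasure := isOpenPosMeasure_of_mulLeftInvariant_of_compact Set.univ isCompact_univ (by rw [measure_univ]; exact one_ne_zero)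
  -- a sup bound for `ψ`
  obtain ⟨M₀, hM₀⟩ := hψ.bounded_above_of_compact_support hψs
  set M : ℝ := max M₀ 0 with hMdef
  have hM : ∀ x, ‖ψ x‖ ≤ M := fun x => (hM₀ x).trans (le_max_left _ _)
  have hM0 : 0 ≤ M := le_max_right _ _
  -- Step 1: uniform neighbourhood
  obtain ⟨u, hu, h1u, hU⟩ := exists_nhds_one_forall_norm_sub_le (C := C) hψ hψs (half_pos hε)
  -- Step 2: an Urysohn bump at `1` supported in `u`, normalised
  obtain ⟨b, hb1, hb0, -, hb01⟩ := exists_continuous_one_zero_of_isCompact (isCompact_singleton : IsCompact ({1} : Set C)) hu.isClosed_compl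
    (Set.disjoint_singleton_left.2 fun h => h h1u)
  have hbnn : ∀ c, 0 ≤ b c := fun c => (hb01 c).1
  have hbu : ∀ c, b c ≠ 0 → c ∈ u := fun c hc => by
    by_contra hcu
    exact hc (hb0 hcu)
  set I : ℝ := ∫ c, b c ∂μC with hIdef
  have hIpos : 0 < I := b.continuous.integral_pos_of_hasCompactSupport_nonneg_nonzero (HasCompactSupport.of_compactSpace _) hbnn
    (x := 1) (by rw [hb1 (Set.mem_singleton 1)]; exact one_ne_zero)
  -- the normalised bump as an element of `C(C, ℂ)`
  set g : C(C, ℂ) := ⟨fun c => ((b c / I : ℝ) : ℂ), Complex.continuous_ofReal.comp (b.continuous.div_const I)⟩ with hgdef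
  have hg_apply : ∀ c, g c = ((b c / I : ℝ) : ℂ) := fun c => rfl
  have hgint : ∫ c, g c ∂μC = 1 := by
    simp only [hg_apply]
    rw [integral_complex_ofReal, integral_div, ← hIdef, div_self hIpos.ne', Complex.ofReal_one]
  -- Step 3: a trigonometric polynomial close to `g`
  set δ : ℝ := ε / (2 * (M + 1)) with hδdef
  have hδ : 0 < δ := by rw [hδdef]; positivity
  obtain ⟨s, a, hpa⟩ := exists_finset_character_sup_approx g hδ
  -- the answer: reindex by `χ ↦ χ⁻¹` to land on the `conj χ` convention
  refine ⟨s.image (·⁻¹), fun χ => a χ⁻¹, fun x => ?_⟩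
  -- integrability facts
  have hcx : Continuous fun c : C => c • x := continuous_id.smul continuous_const
  have hint1 : ∀ χ : PontryaginDual C, Integrable (fun c => star ((χ c : Circle) : ℂ) * ψ (c • x)) μC := fun χ =>
    integrable_of_continuous μC ((continuous_star.comp (continuous_subtype_val.comp (map_continuous χ))).mul (hψ.comp hcx))
  have hintg : Integrable (fun c => g c * ψ (c • x)) μC := integrable_of_continuous μC (g.continuous.mul (hψ.comp hcx))
  have hintp : Integrable (fun c => (∑ χ ∈ s, a χ * ((χ c : Circle) : ℂ)) * ψ (c • x)) μC :=
    integrable_of_continuous μC ((continuous_finsetSum _ fun χ _ => continuous_const.mul (continuous_subtype_val.comp (map_continuous χ))).mul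
      (hψ.comp hcx))
  -- the finite sum of projections is the integral against the trigonometric polynomial
  have hsum : ∑ χ ∈ s.image (·⁻¹), a χ⁻¹ * ∫ c, star ((χ c : Circle) : ℂ) * ψ (c • x) ∂μC = ∫ c, (∑ χ ∈ s, a χ * ((χ c : Circle) : ℂ)) * ψ (c • x) ∂μC := by
    rw [Finset.sum_image (fun χ _ χ' _ h => inv_injective h)]
    simp only [inv_inv]
    have h1 : ∀ χ ∈ s, a χ * ∫ c, star (((χ⁻¹ : PontryaginDual C) c : Circle) : ℂ) * ψ (c • x) ∂μC = ∫ c, a χ * ((χ c : Circle) : ℂ) * ψ (c • x) ∂μC := by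
      intro χ _
      rw [← integral_const_mul]
      refine integral_congr_ae (Filter.Eventually.of_forall fun c => ?_)
      have : star (((χ⁻¹ : PontryaginDual C) c : Circle) : ℂ) = ((χ c : Circle) : ℂ) := by
        rw [show (χ⁻¹ : PontryaginDual C) c = (χ c)⁻¹ from rfl, Circle.coe_inv_eq_conj, Complex.star_def, Complex.conj_conj]
      simp only [this, mul_assoc]
    rw [Finset.sum_congr rfl h1]
    symm
    simp_rw [Finset.sum_mul]
    exact integral_finsetSum _ fun χ _ => integrable_of_continuous μC
      ((continuous_const.mul (continuous_subtype_val.comp (map_continuous χ))).mul (hψ.comp hcx))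
  rw [hsum]
  -- Step 4: the two estimates
  have hA : ‖ψ x - ∫ c, g c * ψ (c • x) ∂μC‖ ≤ ε / 2 := by
    have hrepr : ψ x - ∫ c, g c * ψ (c • x) ∂μC = ∫ c, g c * (ψ x - ψ (c • x)) ∂μC := by
      have h1 : ∫ c, g c * (ψ x - ψ (c • x)) ∂μC = (∫ c, g c ∂μC) * ψ x - ∫ c, g c * ψ (c • x) ∂μC := by
        rw [← integral_mul_const, ← integral_sub ((integrable_of_continuous μC g.continuous).mul_const _) hintg]
        exact integral_congr_ae (Filter.Eventually.of_forall fun c => by simp only [mul_sub])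
      rw [h1, hgint, one_mul]
    rw [hrepr]
    calc ‖∫ c, g c * (ψ x - ψ (c • x)) ∂μC‖ ≤ ∫ c, ‖g c * (ψ x - ψ (c • x))‖ ∂μC := norm_integral_le_integral_norm _
      _ ≤ ∫ c, b c / I * (ε / 2) ∂μC := by
          refine integral_mono_of_nonneg (Filter.Eventually.of_forall fun c => norm_nonneg _)
            (integrable_of_continuous μC ((b.continuous.div_const I).mul continuous_const)) (Filter.Eventually.of_forall fun c => ?_)
          · show ‖g c * (ψ x - ψ (c • x))‖ ≤ b c / I * (ε / 2)
            rw [norm_mul, hg_apply, Complex.norm_real, Real.norm_of_nonneg (div_nonneg (hbnn c) hIpos.le)]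
            by_cases hbc : b c = 0
            · rw [hbc, zero_div, zero_mul, zero_mul]
            · rw [norm_sub_rev]
              exact mul_le_mul_of_nonneg_left (hU c (hbu c hbc) x) (div_nonneg (hbnn c) hIpos.le)
      _ = ε / 2 := by rw [integral_mul_const, integral_div, ← hIdef, div_self hIpos.ne', one_mul]
  have hB : ‖(∫ c, g c * ψ (c • x) ∂μC) - ∫ c, (∑ χ ∈ s, a χ * ((χ c : Circle) : ℂ)) * ψ (c • x) ∂μC‖ ≤ ε / 2 := by
    rw [← integral_sub hintg hintp]
    calc ‖∫ c, (g c * ψ (c • x) - (∑ χ ∈ s, a χ * ((χ c : Circle) : ℂ)) * ψ (c • x)) ∂μC‖ ≤ δ * M * μC.real Set.univ :=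
          norm_integral_le_of_norm_le_const (Filter.Eventually.of_forall fun c => by
            rw [← sub_mul, norm_mul]
            exact mul_le_mul (hpa c) (hM _) (norm_nonneg _) hδ.le)
      _ = δ * M := by rw [probReal_univ, mul_one]
      _ ≤ ε / 2 := by
          rw [hδdef, div_mul_eq_mul_div, div_le_div_iff₀ (by positivity) (by norm_num : (0:ℝ) < 2)]
          nlinarith [hM0, hε]
  calc ‖ψ x - ∫ c, (∑ χ ∈ s, a χ * ((χ c : Circle) : ℂ)) * ψ (c • x) ∂μC‖
      = ‖(ψ x - ∫ c, g c * ψ (c • x) ∂μC) + ((∫ c, g c * ψ (c • x) ∂μC) - ∫ c, (∑ χ ∈ s, a χ * ((χ c : Circle) : ℂ)) * ψ (c • x) ∂μC)‖ := by rw [sub_add_sub_cancel]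
    _ ≤ ε / 2 + ε / 2 := (norm_add_le _ _).trans (add_le_add hA hB)
    _ = ε := by ring

end Summit.HodgeConjecture.HodgeConjecture.Cruxes.H413.K2E1CompactAbelianIsotypicApproximationU

end
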